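import Literature.Probability.RandomPlanarGeometry.SAWAdsorptionDesorbedLoops
import Literature.Probability.RandomPlanarGeometry.SAWPulledHalfSpaceFreeEnergy
import Literature.Probability.RandomPlanarGeometry.SAWPulledBridgeGain
import HarnessLib

/-!
# Adsorbing positive walks pulled at their endpoint (`ℤ²`): the free energy is `κ(a,y) = max[κ(a), λ(y)]`
# (Janse van Rensburg–Whittington 2013, Theorem 1)

Topic `Literature/Probability/RandomPlanarGeometry` (joins two tree lines: the adsorption files — `Zd.hpWalks`, `Zd.wallVisits`,
`Zd.archZ k a = L_k(a)` (loops), `Zd.adsRate a = e^{κ(a)}`, `Zd.adsFreeEnergy`, the last-visit split machinery `Zd.lastWallVisit`,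
`Zd.prefixWalk`, `Zd.suffixWalk` of `SAWAdsorptionArchUnfolding.lean` — and the pulled-walk files — Beaton's weak-half-space walks
`Zd.weakHalfSpaceWalks`, `Zd.pulledU d n y = U_n(y)`, the pulled-bridge free energy `Zd.pulledBridgeFreeEnergy d y = λ_B(y)` and
`Zd.Beaton2015_freeEnergy : n⁻¹ log U_n(y) → max(log μ, λ_B(y))` of `SAWPulledHalfSpaceFreeEnergy.lean`).

Janse van Rensburg–Whittington 2013 (J. Phys. A 46 435003, arXiv:1307.6457 v4), §2 (pp. 3–5): «Let `c_n^+(v,h)` be the number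
of `n`-step positive walks with `v` visits and with `z_n = h` … `C_n(a,y) = Σ_{v,h} c_n^+(v,h) a^v y^h`» (eq. (2.3), p. 4);
**Theorem 1 (p. 4): «The limit `lim_{n→∞} n⁻¹ log C_n(a,y)` exists and is equal to `max[κ(a), λ(y)]`.»** Printed proof: «Every
positive walk is either a loop or it eventually leaves the surface for the last time. This decomposes positive walks into a
loop, followed by a tail» (p. 4); lower bound `C_n(a,y) ≥ max[L‡_n(a), T‡_n(y)]` (p. 4), upper bound `C_n(a,y) ≤ Σ_m L_m(a) T_{n−m}(y)`
and the radius of convergence of the product of generating functions (p. 5); Theorem 2 (p. 5). Here, for the square lattice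
(`d = 2`, wall `x₀ = 0`, height `h = x₀(ω_n)`), with two honest deviations from the printed architecture: (i) the printed upper
bound uses TAILS `T_{n−m}(y)` (positive walks that leave the surface at once and never return); ours uses Beaton's weak-half-space
function `U_{n−k}(y) ⊇ tails` (a weaker-looking, sufficient bound), and the printed `λ(y) = lim n⁻¹ log T_n(y)` (Lemma 2) is
identified with `lim n⁻¹ log U_n(y) = max(log μ, λ_B(y))` through the tree's pulled line (`Zd.Beaton2015_freeEnergy`,
`max_adsFreeEnergy_eq`); (ii) the printed generating-function / radius-of-convergence step (p. 5) is replaced by the elementary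
convolution-of-rates lemma `eventually_log_conv_le`:

* `Zd.adsPulledZ n a y = C_n(a,y)`; `Zd.adsPulledZ_one_right : C_n(a,1) = Z⁺_n(a)`, `Zd.adsPulledZ_one_left : C_n(1,y) = U_n(y)`;
* lower bounds `Zd.archZ_le_adsPulledZ : L_n(a) ≤ C_n(a,y)` (loops end at height `0`) and
  `Zd.pulledBridgeZ_le_adsPulledZ : Z^B_n(y) ≤ C_n(a,y)` (bridges are tails: no visits);
* the loop–tail decomposition **`Zd.adsPulledZ_le_sum : C_n(a,y) ≤ Σ_{k ≤ n} L_k(a) · U_{n−k}(y)`** (cut at the last visit; the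
  tail is a weak-half-space walk carrying the height weight);
* the convolution rate lemma `Zd.eventually_log_conv_le` (`n⁻¹ log Σ_{k≤n} x_k y_{n−k} ≤ max(A,B) + ε` eventually when
  `n⁻¹ log x_n → A`, `n⁻¹ log y_n → B`);
* **`Zd.JansevanRensburgWhittington2013_thm1 : n⁻¹ log C_n(a,y) → max(κ(log a), λ_B(y))`** for `a, y > 0` — and since
  `κ ≥ log μ`, `max(κ(a), λ_B(y)) = max(κ(a), max(log μ, λ_B(y))) = max[κ(a), λ(y)]` (`Zd.max_adsFreeEnergy_eq`);
* §4 consequences (Lemma 5, p. 12: «for `a > a_c^o` there exists `y_c(a)`, `1 ≤ y_c(a) ≤ e^{κ(a,1)}`, such that the free energy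
  is equal to `κ(a,1)` for `y < y_c(a)`»): `Zd.adsPulled_limit_of_le_one` (for `y ≤ 1` the limit is `κ(a)`),
  `Zd.adsPulled_limit_of_exp_lt` (for `y > e^{κ(a)}` the limit is `λ_B(y) > κ(a)`: ballistic).

Label: CONSOLIDATION (Theorem 1 of Janse van Rensburg–Whittington 2013 for `d = 2`, vertex weights; the printed generating-function
step is replaced by an elementary convolution-of-rates lemma). Pure standard axioms. (Lane «pcv-sawmu», a-p3 g12.)
-/

noncomputable section

open Finset Filter Topology Literature.Probability.LatticeModels SimpleGraph
open scoped BigOperators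

namespace Literature.Probability.RandomPlanarGeometry.SAW.Zd

/-! ### The two-variable partition function -/

/-- **`C_n(a,y) = Σ_{v,h} c_n^+(v,h) a^v y^h`** — positive (half-plane) `n`-step walks of `ℤ²` from the origin, weight `a` per
wall visit and `y` per unit of final height `h = x₀(ω_n) ≥ 0`.
[cite: JansevanRensburgWhittington2013, §2 eq. (2.3) (arXiv v4 p. 4: «C_n(a,y) = Σ_{v,h} c_n^+(v,h) a^v y^h»)] -/
def adsPulledZ (n : ℕ) (a y : ℝ) : ℝ := ∑ ω ∈ hpWalks n, a ^ wallVisits n ω * y ^ (ω n 0).toNat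

/-- `C_n(a,y) ≥ 0` for `a, y ≥ 0`. [cite: JansevanRensburgWhittington2013, §2 eq. (2.3) (arXiv v4 p. 4)] -/
theorem adsPulledZ_nonneg (n : ℕ) {a y : ℝ} (ha : 0 ≤ a) (hy : 0 ≤ y) : 0 ≤ adsPulledZ n a y :=
  Finset.sum_nonneg fun _ _ => mul_nonneg (pow_nonneg ha _) (pow_nonneg hy _)

/-- **`C_n(a,1) = Z⁺_n(a)`.** [cite: JansevanRensburgWhittington2013, §2 (arXiv v4 p. 3–4: C_n(a) and C_n(a,y); §4 p. 10: «κ(a,1) = κ(a)»)] -/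
theorem adsPulledZ_one_right (n : ℕ) (a : ℝ) : adsPulledZ n a 1 = adsZ n a := by
  simp [adsPulledZ, adsZ]

/-- The half-plane walks of the adsorption files are Beaton's weak-half-space walks of `ℤ²`. [cite: Beaton2015, §2 (p. 3)] -/
theorem hpWalks_eq_weakHalfSpaceWalks (n : ℕ) : hpWalks n = weakHalfSpaceWalks 2 n := by
  ext ω
  rw [mem_hpWalks, mem_weakHalfSpaceWalks]

/-- **`C_n(1,y) = U_n(y)`** (Beaton's pulled half-space partition function). [cite: JansevanRensburgWhittington2013, §2 (arXiv v4 p. 4: T_n(y), λ(y))] [cite: Beaton2015, §2 (p. 3: U_n(y))] -/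
theorem adsPulledZ_one_left (n : ℕ) (y : ℝ) : adsPulledZ n 1 y = pulledU 2 n y := by
  simp [adsPulledZ, pulledU, hpWalks_eq_weakHalfSpaceWalks]

/-! ### Lower bounds: loops and bridges -/

/-- **`L_n(a) ≤ C_n(a,y)`**: loops end at height `0`. [cite: JansevanRensburgWhittington2013, §2, proof of Theorem 1 (arXiv v4 p. 4: «C_n(a,y) ≥ max[L‡_n(a), T‡_n(y)]»)] -/
theorem archZ_le_adsPulledZ (n : ℕ) {a y : ℝ} (ha : 0 ≤ a) (hy : 0 ≤ y) : archZ n a ≤ adsPulledZ n a y := by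
  classical
  rw [archZ, adsPulledZ]
  have hsub : arches n ⊆ hpWalks n := Finset.filter_subset _ _
  calc ∑ ω ∈ arches n, a ^ wallVisits n ω = ∑ ω ∈ arches n, a ^ wallVisits n ω * y ^ (ω n 0).toNat := by
        refine Finset.sum_congr rfl fun ω hω => ?_
        rw [(mem_arches.1 hω).2]; simp
    _ ≤ ∑ ω ∈ hpWalks n, a ^ wallVisits n ω * y ^ (ω n 0).toNat :=
        Finset.sum_le_sum_of_subset_of_nonneg hsub fun _ _ _ => mul_nonneg (pow_nonneg ha _) (pow_nonneg hy _)

/-- **`Z^B_n(y) ≤ C_n(a,y)`**: a bridge is a positive walk with no visits (a tail), weight `y^h`.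
[cite: JansevanRensburgWhittington2013, §2, proof of Theorem 1 (arXiv v4 p. 4: «C_n(a,y) ≥ max[L‡_n(a), T‡_n(y)]»)] -/
theorem pulledBridgeZ_le_adsPulledZ (n : ℕ) {a y : ℝ} (ha : 0 ≤ a) (hy : 0 ≤ y) : pulledBridgeZ 2 n y ≤ adsPulledZ n a y := by
  classical
  rw [pulledBridgeZ_eq_sum_bridges, adsPulledZ]
  calc ∑ ω ∈ bridges 2 n, y ^ (ω n 0).toNat = ∑ ω ∈ bridges 2 n, a ^ wallVisits n ω * y ^ (ω n 0).toNat := by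
        refine Finset.sum_congr rfl fun ω hω => ?_
        rw [wallVisits_eq_zero_of_mem_bridges hω, pow_zero, one_mul]
    _ ≤ ∑ ω ∈ hpWalks n, a ^ wallVisits n ω * y ^ (ω n 0).toNat :=
        Finset.sum_le_sum_of_subset_of_nonneg (bridges_subset_hpWalks n)
          fun _ _ _ => mul_nonneg (pow_nonneg ha _) (pow_nonneg hy _)

/-- `C_n(a,y) > 0` for `a ≥ 0`, `y > 0`. [cite: JansevanRensburgWhittington2013, §2 eq. (2.3) (arXiv v4 p. 4)] -/
theorem adsPulledZ_pos (n : ℕ) {a y : ℝ} (ha : 0 ≤ a) (hy : 0 < y) : 0 < adsPulledZ n a y :=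
  lt_of_lt_of_le (pulledBridgeZ_pos 1 n hy) (pulledBridgeZ_le_adsPulledZ n ha hy.le)

/-! ### The loop–tail decomposition (upper bound) -/

/-- Reindexing inequality: an injection into a finset carrying nonnegative weights. [folklore] -/
private theorem sum_comp_le_sum_of_injOn'' {ι κ : Type*} [DecidableEq κ] {s : Finset ι} {t : Finset κ}
    (e : ι → κ) (he : Set.InjOn e s) (hst : ∀ x ∈ s, e x ∈ t) (g : κ → ℝ)
    (hg : ∀ y ∈ t, 0 ≤ g y) : ∑ x ∈ s, g (e x) ≤ ∑ y ∈ t, g y := by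
  rw [← Finset.sum_image (f := g) he]
  exact Finset.sum_le_sum_of_subset_of_nonneg (Finset.image_subset_iff.2 hst) fun b hb _ => hg b hb

/-- After its last visit, a positive walk (re-based) is a weak-half-space walk whose final height is that of the walk.
[cite: JansevanRensburgWhittington2013, §2, proof of Theorem 1 (arXiv v4 p. 4: «a loop, followed by a tail»)] -/
theorem suffixWalk_lastWallVisit_mem {n : ℕ} {ω : ℕ → Site 2} (hω : ω ∈ hpWalks n) :
    suffixWalk (lastWallVisit n ω) (n - lastWallVisit n ω) ω ∈ weakHalfSpaceWalks 2 (n - lastWallVisit n ω) ∧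
      suffixWalk (lastWallVisit n ω) (n - lastWallVisit n ω) ω (n - lastWallVisit n ω) 0 = ω n 0 := by
  obtain ⟨hs, hpos⟩ := mem_hpWalks.1 hω
  have hk := lastWallVisit_le n ω
  have h0 : ω (lastWallVisit n ω) 0 = 0 := apply_lastWallVisit (mem_saws.1 hs).1
  refine ⟨mem_weakHalfSpaceWalks.2 ⟨suffixWalk_mem_saws hs (by omega), fun i hi => ?_⟩, ?_⟩
  · simp only [suffixWalk, min_eq_left hi, Pi.sub_apply, h0, sub_zero]
    exact hpos _ (by omega)
  · simp only [suffixWalk, min_self, Pi.sub_apply, h0, sub_zero, Nat.add_sub_cancel' hk]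

/-- The walks with last visit at time `k` weigh at most `L_k(a) · U_{n-k}(y)`.
[cite: JansevanRensburgWhittington2013, §2, proof of Theorem 1 (arXiv v4 p. 5: «C_n(a,y) ≤ Σ_m L_m(a) T_{n−m}(y)»)] -/
theorem sum_filter_lastWallVisit_le_pulled {n k : ℕ} (hkn : k ≤ n) {a y : ℝ} (ha : 0 ≤ a) (hy : 0 ≤ y) :
    ∑ ω ∈ (hpWalks n).filter (fun ω => lastWallVisit n ω = k), a ^ wallVisits n ω * y ^ (ω n 0).toNat ≤
      archZ k a * pulledU 2 (n - k) y := by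
  classical
  set S := (hpWalks n).filter (fun ω => lastWallVisit n ω = k) with hS
  have hmemS : ∀ ω ∈ S, ω ∈ hpWalks n ∧ lastWallVisit n ω = k := fun ω hω => Finset.mem_filter.1 hω
  have heq : ∀ ω ∈ S, a ^ wallVisits n ω * y ^ (ω n 0).toNat =
      a ^ wallVisits k (prefixWalk k ω) * y ^ (suffixWalk k (n - k) ω (n - k) 0).toNat := by
    intro ω hω
    obtain ⟨hω', hk⟩ := hmemS ω hω
    have h2 := (suffixWalk_lastWallVisit_mem hω').2
    rw [hk] at h2
    rw [← hk, wallVisits_prefixWalk_lastWallVisit, hk, h2]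
  rw [Finset.sum_congr rfl heq]
  have hle : ∑ ω ∈ S, a ^ wallVisits k (prefixWalk k ω) * y ^ (suffixWalk k (n - k) ω (n - k) 0).toNat ≤
      ∑ p ∈ arches k ×ˢ weakHalfSpaceWalks 2 (n - k), a ^ wallVisits k p.1 * y ^ (p.2 (n - k) 0).toNat :=
    sum_comp_le_sum_of_injOn'' (s := S) (t := arches k ×ˢ weakHalfSpaceWalks 2 (n - k))
      (fun ω => (prefixWalk k ω, suffixWalk k (n - k) ω))
      (fun ω hω ω' hω' h => prefix_suffix_injOn hkn (Finset.mem_coe.2 (mem_hpWalks.1 (hmemS ω hω).1).1)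
        (Finset.mem_coe.2 (mem_hpWalks.1 (hmemS ω' hω').1).1) h)
      (fun ω hω => by
        obtain ⟨hω', hk⟩ := hmemS ω hω
        rw [Finset.mem_product]
        have h1 := prefixWalk_lastWallVisit_mem_arches hω'
        have h2 := (suffixWalk_lastWallVisit_mem hω').1
        rw [hk] at h1 h2
        exact ⟨h1, h2⟩)
      (fun p => a ^ wallVisits k p.1 * y ^ (p.2 (n - k) 0).toNat)
      (fun _ _ => mul_nonneg (pow_nonneg ha _) (pow_nonneg hy _))
  refine hle.trans (le_of_eq ?_)
  rw [Finset.sum_product, archZ, pulledU, Finset.sum_mul]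
  refine Finset.sum_congr rfl fun ω _ => ?_
  rw [Finset.mul_sum]

/-- **Loop–tail decomposition: `C_n(a,y) ≤ Σ_{k=0}^{n} L_k(a) · U_{n−k}(y)`** (`a, y ≥ 0`).
[cite: JansevanRensburgWhittington2013, §2, proof of Theorem 1 (arXiv v4 p. 5: «C_n(a,y) ≤ Σ_m L_m(a) T_{n−m}(y)»)] -/
theorem adsPulledZ_le_sum (n : ℕ) {a y : ℝ} (ha : 0 ≤ a) (hy : 0 ≤ y) :
    adsPulledZ n a y ≤ ∑ k ∈ Finset.range (n + 1), archZ k a * pulledU 2 (n - k) y := by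
  classical
  unfold adsPulledZ
  rw [← Finset.sum_fiberwise_of_maps_to (s := hpWalks n) (t := Finset.range (n + 1)) (g := lastWallVisit n)
    (fun ω _ => Finset.mem_range.2 (Nat.lt_succ_of_le (lastWallVisit_le n ω)))]
  exact Finset.sum_le_sum fun k hk =>
    sum_filter_lastWallVisit_le_pulled (Nat.le_of_lt_succ (Finset.mem_range.1 hk)) ha hy

/-! ### Rates: the convolution lemma -/

/-- A sequence with `n⁻¹ log x_n → A` is dominated by `C e^{(A+ε) n}` for ALL `n` (`x_n > 0`).
[cite: MadrasSlade1993, Lemma 1.2.2 (p. 9)] -/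
theorem exists_le_mul_exp_of_tendsto {x : ℕ → ℝ} {A ε : ℝ} (hx : ∀ n, 0 < x n)
    (hA : Tendsto (fun n : ℕ => Real.log (x n) / n) atTop (𝓝 A)) (hε : 0 < ε) :
    ∃ C : ℝ, 0 < C ∧ ∀ n : ℕ, x n ≤ C * Real.exp ((A + ε) * n) := by
  have hev : ∀ᶠ n : ℕ in atTop, x n ≤ Real.exp ((A + ε) * n) := by
    filter_upwards [hA.eventually (eventually_lt_nhds (lt_add_of_pos_right A hε)), eventually_gt_atTop 0] with n hn hn0
    have hn' : (0 : ℝ) < n := by exact_mod_cast hn0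
    rw [div_lt_iff₀ hn'] at hn
    calc x n = Real.exp (Real.log (x n)) := (Real.exp_log (hx n)).symm
      _ ≤ Real.exp ((A + ε) * n) := Real.exp_le_exp.2 hn.le
  obtain ⟨N, hN⟩ := eventually_atTop.1 hev
  set C := 1 + ∑ k ∈ Finset.range N, x k * Real.exp (-((A + ε) * k)) with hC
  have hC1 : 1 ≤ C := by
    rw [hC]; exact le_add_of_nonneg_right (Finset.sum_nonneg fun k _ => by positivity [hx k])
  refine ⟨C, by linarith, fun n => ?_⟩
  rcases lt_or_ge n N with hn | hn
  · have hterm : x n * Real.exp (-((A + ε) * n)) ≤ C := by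
      rw [hC]
      refine le_trans (Finset.single_le_sum (f := fun k => x k * Real.exp (-((A + ε) * k)))
        (fun k _ => by positivity [hx k]) (Finset.mem_range.2 hn)) (by linarith)
    have hexp : 0 < Real.exp ((A + ε) * n) := Real.exp_pos _
    calc x n = x n * Real.exp (-((A + ε) * n)) * Real.exp ((A + ε) * n) := by
          rw [mul_assoc, ← Real.exp_add, neg_add_cancel, Real.exp_zero, mul_one]
      _ ≤ C * Real.exp ((A + ε) * n) := mul_le_mul_of_nonneg_right hterm hexp.le
  · calc x n ≤ Real.exp ((A + ε) * n) := hN n hn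
      _ ≤ C * Real.exp ((A + ε) * n) := le_mul_of_one_le_left (Real.exp_pos _).le hC1

/-- `n⁻¹ log (n+1) → 0` along the naturals. [folklore] -/
private theorem tendsto_log_succ_div : Tendsto (fun n : ℕ => Real.log ((n : ℝ) + 1) / n) atTop (𝓝 0) := by
  -- `log(n+1)/(n+1) → 0` and `(n+1)/n → 1`
  have hx : Tendsto (fun n : ℕ => (n : ℝ) + 1) atTop atTop :=
    tendsto_atTop_add_const_right _ 1 tendsto_natCast_atTop_atTop
  have h := (Real.tendsto_pow_log_div_mul_add_atTop 1 (-1) 1 one_ne_zero).comp hx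
  refine h.congr fun n => ?_
  simp only [Function.comp, pow_one]
  ring_nf

/-- **Convolution of exponential rates**: if `x_n, y_n > 0`, `n⁻¹ log x_n → A` and `n⁻¹ log y_n → B`, then for every `ε > 0`,
eventually `n⁻¹ log Σ_{k ≤ n} x_k y_{n−k} ≤ max(A,B) + ε` (the radius-of-convergence step of the printed proof, done by hand).
[cite: JansevanRensburgWhittington2013, §2, proof of Theorem 1 (arXiv v4 p. 5: «the product … has radius of convergence min{t_1, t_2}»; this lemma replaces the printed radius-of-convergence argument)] -/
theorem eventually_log_conv_le {x y : ℕ → ℝ} {A B ε : ℝ} (hx : ∀ n, 0 < x n) (hy : ∀ n, 0 < y n)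
    (hA : Tendsto (fun n : ℕ => Real.log (x n) / n) atTop (𝓝 A))
    (hB : Tendsto (fun n : ℕ => Real.log (y n) / n) atTop (𝓝 B)) (hε : 0 < ε) :
    ∀ᶠ n : ℕ in atTop, Real.log (∑ k ∈ Finset.range (n + 1), x k * y (n - k)) / n ≤ max A B + ε := by
  obtain ⟨C, hC, hxC⟩ := exists_le_mul_exp_of_tendsto hx hA (half_pos hε)
  obtain ⟨D, hD, hyD⟩ := exists_le_mul_exp_of_tendsto hy hB (half_pos hε)
  set M := max A B with hM
  -- `Σ_k x_k y_{n-k} ≤ (n+1) C D e^{(M + ε/2) n}`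
  have hsum : ∀ n : ℕ, ∑ k ∈ Finset.range (n + 1), x k * y (n - k) ≤
      ((n : ℝ) + 1) * (C * D) * Real.exp ((M + ε / 2) * n) := by
    intro n
    have hterm : ∀ k ∈ Finset.range (n + 1), x k * y (n - k) ≤ C * D * Real.exp ((M + ε / 2) * n) := by
      intro k hk
      have hkn : k ≤ n := Nat.le_of_lt_succ (Finset.mem_range.1 hk)
      have h1 := hxC k
      have h2 := hyD (n - k)
      have hcast : ((n - k : ℕ) : ℝ) = n - k := by push_cast [Nat.cast_sub hkn]; ring
      have hexp : Real.exp ((A + ε / 2) * k) * Real.exp ((B + ε / 2) * ((n - k : ℕ) : ℝ)) ≤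
          Real.exp ((M + ε / 2) * n) := by
        rw [← Real.exp_add, hcast]
        refine Real.exp_le_exp.2 ?_
        have hk0 : (0 : ℝ) ≤ k := Nat.cast_nonneg k
        have hnk : (0 : ℝ) ≤ n - k := by rw [sub_nonneg]; exact_mod_cast hkn
        have hA' : A ≤ M := le_max_left _ _
        have hB' : B ≤ M := le_max_right _ _
        nlinarith
      calc x k * y (n - k) ≤ (C * Real.exp ((A + ε / 2) * k)) * (D * Real.exp ((B + ε / 2) * ((n - k : ℕ) : ℝ))) :=
            mul_le_mul h1 h2 (hy _).le (by positivity)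
        _ = C * D * (Real.exp ((A + ε / 2) * k) * Real.exp ((B + ε / 2) * ((n - k : ℕ) : ℝ))) := by ring
        _ ≤ C * D * Real.exp ((M + ε / 2) * n) := mul_le_mul_of_nonneg_left hexp (by positivity)
    calc ∑ k ∈ Finset.range (n + 1), x k * y (n - k) ≤ ∑ k ∈ Finset.range (n + 1), C * D * Real.exp ((M + ε / 2) * n) :=
          Finset.sum_le_sum hterm
      _ = ((n : ℝ) + 1) * (C * D) * Real.exp ((M + ε / 2) * n) := by
          rw [Finset.sum_const, Finset.card_range, nsmul_eq_mul]; push_cast; ring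
  -- `n⁻¹ log((n+1) C D) → 0`
  have hsmall : Tendsto (fun n : ℕ => Real.log (((n : ℝ) + 1) * (C * D)) / n) atTop (𝓝 0) := by
    have h1 := tendsto_log_succ_div
    have h2 : Tendsto (fun n : ℕ => Real.log (C * D) / n) atTop (𝓝 0) := tendsto_const_nhds.div_atTop tendsto_natCast_atTop_atTop
    have h3 := h1.add h2
    rw [add_zero] at h3
    refine h3.congr' ?_
    filter_upwards [eventually_gt_atTop 0] with n hn
    rw [Real.log_mul (show ((n : ℝ) + 1) ≠ 0 by positivity) (show C * D ≠ 0 by positivity), add_div]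
  filter_upwards [hsmall.eventually (eventually_lt_nhds (half_pos hε)), eventually_gt_atTop 0] with n hn hn0
  have hn' : (0 : ℝ) < n := by exact_mod_cast hn0
  have hpos : 0 < ∑ k ∈ Finset.range (n + 1), x k * y (n - k) :=
    Finset.sum_pos (fun k _ => mul_pos (hx k) (hy _)) ⟨0, Finset.mem_range.2 (Nat.succ_pos n)⟩
  have hlog := Real.log_le_log hpos (hsum n)
  rw [Real.log_mul (by positivity) (Real.exp_pos _).ne', Real.log_exp] at hlog
  rw [div_le_iff₀ hn']
  have := (div_lt_iff₀ hn').1 hn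
  nlinarith

/-! ### Theorem 1 -/

/-- `n⁻¹ log L_n(a) → κ(log a)` for `a > 0` (the loops limit of Lemma 1, logarithmic form).
[cite: JansevanRensburgWhittington2013, Lemma 1 (arXiv v4 p. 3)] -/
theorem tendsto_log_archZ_div {a : ℝ} (ha : 0 < a) :
    Tendsto (fun n : ℕ => Real.log (archZ n a) / n) atTop (𝓝 (adsFreeEnergy (Real.log a))) := by
  have h := (JansevanRensburgWhittington2013_lemma1_pos ha).2.1
  have hR := adsRate_pos ha.le
  have hlog := (Real.continuousAt_log hR.ne').tendsto.comp h
  rw [adsFreeEnergy, Real.exp_log ha]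
  refine hlog.congr' ?_
  filter_upwards [eventually_gt_atTop 0] with n hn
  have hpos : 0 < archZ n a := lt_of_lt_of_le (AdsIrr.Bw_pos n ha) (Bw_le_archZ n ha.le)
  simp only [Function.comp]
  rw [Real.log_rpow hpos, one_div, inv_mul_eq_div]

/-- `n⁻¹ log Z^B_n(y) → λ_B(y)` on `ℤ²` (`y > 0`). [cite: Beaton2015, §3; MadrasSlade1993, Lemma 1.2.2] -/
theorem tendsto_log_pulledBridgeZ_two_div {y : ℝ} (hy : 0 < y) :
    Tendsto (fun n : ℕ => Real.log (pulledBridgeZ 2 n y) / n) atTop (𝓝 (pulledBridgeFreeEnergy 2 y)) :=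
  tendsto_pulledBridgeFreeEnergy 1 hy

/-- `n⁻¹ log U_n(y) → max(log μ, λ_B(y))` on `ℤ²` (`y > 0`): Beaton's free energy `λ(y)`.
[cite: Beaton2015, §2 (p. 3: existence of λ(y)); JansevanRensburgWhittington2013, Lemma 2 (arXiv v4 p. 4)] -/
theorem tendsto_log_pulledU_two_div {y : ℝ} (hy : 0 < y) :
    Tendsto (fun n : ℕ => Real.log (pulledU 2 n y) / n) atTop
      (𝓝 (max (Real.log (connectiveConstant 2)) (pulledBridgeFreeEnergy 2 y))) :=
  Beaton2015_freeEnergy 0 hy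

/-- `max(κ(log a), λ_B(y)) = max[κ(a), λ(y)]` with `λ(y) = max(log μ, λ_B(y))`, because `κ ≥ log μ`.
[cite: JansevanRensburgWhittington2013, Theorem 1 (arXiv v4 p. 4)] -/
theorem max_adsFreeEnergy_eq {a : ℝ} (ha : 0 < a) (y : ℝ) :
    max (adsFreeEnergy (Real.log a)) (pulledBridgeFreeEnergy 2 y) =
      max (adsFreeEnergy (Real.log a)) (max (Real.log (connectiveConstant 2)) (pulledBridgeFreeEnergy 2 y)) := by
  have hμ : Real.log (connectiveConstant 2) ≤ adsFreeEnergy (Real.log a) := by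
    rw [adsFreeEnergy, Real.exp_log ha]
    exact Real.log_le_log (connectiveConstant_pos 2) (connectiveConstant_le_adsRate ha.le)
  rw [← max_assoc, max_eq_left hμ]

/-- **Theorem 1 (Janse van Rensburg–Whittington 2013), `d = 2`: `lim n⁻¹ log C_n(a,y)` exists and equals `max[κ(a), λ(y)]`**
(here `= max(κ(log a), λ_B(y))`, see `max_adsFreeEnergy_eq`), for every `a > 0`, `y > 0`.
[cite: JansevanRensburgWhittington2013, Theorem 1 (arXiv v4 p. 4: «The limit lim n⁻¹ log C_n(a,y) exists and is equal to max[κ(a), λ(y)]»)] -/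
theorem JansevanRensburgWhittington2013_thm1 {a y : ℝ} (ha : 0 < a) (hy : 0 < y) :
    Tendsto (fun n : ℕ => Real.log (adsPulledZ n a y) / n) atTop
      (𝓝 (max (adsFreeEnergy (Real.log a)) (pulledBridgeFreeEnergy 2 y))) := by
  set M := max (adsFreeEnergy (Real.log a)) (pulledBridgeFreeEnergy 2 y) with hM
  have hL := tendsto_log_archZ_div ha
  have hB := tendsto_log_pulledBridgeZ_two_div hy
  have hU := tendsto_log_pulledU_two_div hy
  have hCpos : ∀ n, 0 < adsPulledZ n a y := fun n => adsPulledZ_pos n ha.le hy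
  have hLpos : ∀ n, 0 < archZ n a := fun n => lt_of_lt_of_le (AdsIrr.Bw_pos n ha) (Bw_le_archZ n ha.le)
  have hUpos : ∀ n, 0 < pulledU 2 n y := fun n => lt_of_lt_of_le (pulledBridgeZ_pos 1 n hy) (pulledBridgeZ_le_pulledU n hy.le)
  rw [tendsto_order]
  refine ⟨fun b hb => ?_, fun b hb => ?_⟩
  · -- lower bound: `C_n ≥ L_n` and `C_n ≥ Z^B_n`
    rcases lt_max_iff.1 hb with hb1 | hb2
    · filter_upwards [(tendsto_order.1 hL).1 b hb1, eventually_gt_atTop 0] with n hn hn0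
      have hn' : (0 : ℝ) < n := by exact_mod_cast hn0
      refine lt_of_lt_of_le hn (div_le_div_of_nonneg_right ?_ hn'.le)
      exact Real.log_le_log (hLpos n) (archZ_le_adsPulledZ n ha.le hy.le)
    · filter_upwards [(tendsto_order.1 hB).1 b hb2, eventually_gt_atTop 0] with n hn hn0
      have hn' : (0 : ℝ) < n := by exact_mod_cast hn0
      refine lt_of_lt_of_le hn (div_le_div_of_nonneg_right ?_ hn'.le)
      exact Real.log_le_log (pulledBridgeZ_pos 1 n hy) (pulledBridgeZ_le_adsPulledZ n ha.le hy.le)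
  · -- upper bound: the loop–tail decomposition and the convolution lemma
    have hε : 0 < (b - M) / 2 := by linarith
    have hconv := eventually_log_conv_le hLpos hUpos hL hU hε
    have hmax : max (adsFreeEnergy (Real.log a)) (max (Real.log (connectiveConstant 2)) (pulledBridgeFreeEnergy 2 y)) = M := by
      rw [hM, max_adsFreeEnergy_eq ha]
    rw [hmax] at hconv
    filter_upwards [hconv, eventually_gt_atTop 0] with n hn hn0
    have hn' : (0 : ℝ) < n := by exact_mod_cast hn0
    have hle : Real.log (adsPulledZ n a y) / n ≤
        Real.log (∑ k ∈ Finset.range (n + 1), archZ k a * pulledU 2 (n - k) y) / n :=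
      div_le_div_of_nonneg_right (Real.log_le_log (hCpos n) (adsPulledZ_le_sum n ha.le hy.le)) hn'.le
    linarith

/-- **Theorem 1, printed form of the limit: `κ(a,y) = max[κ(a), λ(y)]`** with `λ(y) = lim n⁻¹ log U_n(y) = max(log μ, λ_B(y))`.
[cite: JansevanRensburgWhittington2013, Theorem 1 (arXiv v4 p. 4)] -/
theorem JansevanRensburgWhittington2013_thm1' {a y : ℝ} (ha : 0 < a) (hy : 0 < y) :
    Tendsto (fun n : ℕ => Real.log (adsPulledZ n a y) / n) atTop
      (𝓝 (max (adsFreeEnergy (Real.log a)) (max (Real.log (connectiveConstant 2)) (pulledBridgeFreeEnergy 2 y)))) := by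
  rw [← max_adsFreeEnergy_eq ha]; exact JansevanRensburgWhittington2013_thm1 ha hy

/-! ### §4: the free phase and the phase boundary `1 ≤ y_c(a) ≤ e^{κ(a)}` -/

/-- **For `y ≤ 1` the pull is irrelevant: `n⁻¹ log C_n(a,y) → κ(log a)`** (`λ_B(y) ≤ λ_B(1) = log μ ≤ κ`).
[cite: JansevanRensburgWhittington2013, §4 Lemma 5 (arXiv v4 p. 12: «κ(a,y) = κ(a,1) for y ≤ 1»)] -/
theorem adsPulled_limit_of_le_one {a y : ℝ} (ha : 0 < a) (hy : 0 < y) (hy1 : y ≤ 1) :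
    Tendsto (fun n : ℕ => Real.log (adsPulledZ n a y) / n) atTop (𝓝 (adsFreeEnergy (Real.log a))) := by
  have h := JansevanRensburgWhittington2013_thm1 ha hy
  have hle : pulledBridgeFreeEnergy 2 y ≤ adsFreeEnergy (Real.log a) := by
    calc pulledBridgeFreeEnergy 2 y ≤ pulledBridgeFreeEnergy 2 1 := pulledBridgeFreeEnergy_mono 1 hy hy1
      _ = Real.log (connectiveConstant 2) := pulledBridgeFreeEnergy_one 1
      _ ≤ adsFreeEnergy (Real.log a) := by
          rw [adsFreeEnergy, Real.exp_log ha]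
          exact Real.log_le_log (connectiveConstant_pos 2) (connectiveConstant_le_adsRate ha.le)
  rwa [max_eq_left hle] at h

/-- **For `y > e^{κ(a)}` the walk is ballistic: `n⁻¹ log C_n(a,y) → λ_B(y) > κ(log a)`** (`λ_B(y) ≥ log y`), i.e. `y_c(a) ≤ e^{κ(a)}`.
[cite: JansevanRensburgWhittington2013, §4 Lemma 5 (arXiv v4 p. 12: «1 ≤ y_c(a) ≤ e^{κ(a,1)}»)] -/
theorem adsPulled_limit_of_exp_lt {a y : ℝ} (ha : 0 < a) (hy : Real.exp (adsFreeEnergy (Real.log a)) < y) :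
    adsFreeEnergy (Real.log a) < pulledBridgeFreeEnergy 2 y ∧
      Tendsto (fun n : ℕ => Real.log (adsPulledZ n a y) / n) atTop (𝓝 (pulledBridgeFreeEnergy 2 y)) := by
  have hy0 : 0 < y := (Real.exp_pos _).trans hy
  have hlt : adsFreeEnergy (Real.log a) < pulledBridgeFreeEnergy 2 y := by
    calc adsFreeEnergy (Real.log a) = Real.log (Real.exp (adsFreeEnergy (Real.log a))) := (Real.log_exp _).symm
      _ < Real.log y := Real.log_lt_log (Real.exp_pos _) hy
      _ ≤ pulledBridgeFreeEnergy 2 y := log_le_pulledBridgeFreeEnergy 1 hy0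
  have h := JansevanRensburgWhittington2013_thm1 ha hy0
  rw [max_eq_right hlt.le] at h
  exact ⟨hlt, h⟩

/-- **Free phase: for `a < a_c` and `y ≤ 1`, `n⁻¹ log C_n(a,y) → log μ`.**
[cite: JansevanRensburgWhittington2013, §4 (arXiv v4 p. 12: «If a < a_c^o and y < y_c^o then κ(a) = λ(y) = log μ_d … a free phase»)] -/
theorem adsPulled_limit_free {a y : ℝ} (ha : 0 < a) (hac : a < adsCriticalFugacity) (hy : 0 < y) (hy1 : y ≤ 1) :
    Tendsto (fun n : ℕ => Real.log (adsPulledZ n a y) / n) atTop (𝓝 (Real.log (connectiveConstant 2))) := by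
  have h := adsPulled_limit_of_le_one ha hy hy1
  rwa [adsFreeEnergy, Real.exp_log ha, adsRate_eq_of_lt_adsCriticalFugacity ha.le hac] at h

/-! ### Theorem 2: `κ(a,y)` is convex in `(log a, log y)` -/

/-- **Hölder in two fugacities**: `C_n(a^θ b^{1-θ}, y^θ z^{1-θ}) ≤ C_n(a,y)^θ · C_n(b,z)^{1-θ}` (`a,b,y,z > 0`, `0 < θ < 1`).
[cite: JansevanRensburgWhittington2013, Theorem 2 (arXiv v4 p. 5: «κ(a,y) is a convex function of log a and log y»)] -/
theorem adsPulledZ_rpow_mul_rpow_le (n : ℕ) {a b y z θ : ℝ} (ha : 0 < a) (hb : 0 < b) (hy : 0 < y) (hz : 0 < z)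
    (hθ0 : 0 < θ) (hθ1 : θ < 1) :
    adsPulledZ n (a ^ θ * b ^ (1 - θ)) (y ^ θ * z ^ (1 - θ)) ≤ adsPulledZ n a y ^ θ * adsPulledZ n b z ^ (1 - θ) := by
  have h1θ : 0 < 1 - θ := by linarith
  have hpq : (1 / θ).HolderConjugate (1 / (1 - θ)) := Real.holderConjugate_one_div hθ0 h1θ (by ring)
  -- the summand splits as `(a^v y^h)^θ · (b^v z^h)^{1-θ}`
  have hpowsplit : ∀ (c d : ℝ) (hc : 0 < c) (hd : 0 < d) (v : ℕ), (c ^ θ * d ^ (1 - θ)) ^ v = (c ^ v) ^ θ * (d ^ v) ^ (1 - θ) := by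
    intro c d hc hd v
    rw [mul_pow, ← Real.rpow_natCast (c ^ θ), ← Real.rpow_natCast (d ^ (1 - θ)), ← Real.rpow_mul hc.le,
      ← Real.rpow_mul hd.le, mul_comm θ, mul_comm (1 - θ), Real.rpow_mul hc.le, Real.rpow_mul hd.le,
      Real.rpow_natCast, Real.rpow_natCast]
  have hsplit : ∀ (v h : ℕ), (a ^ θ * b ^ (1 - θ)) ^ v * (y ^ θ * z ^ (1 - θ)) ^ h =
      (a ^ v * y ^ h) ^ θ * (b ^ v * z ^ h) ^ (1 - θ) := by
    intro v h
    rw [hpowsplit a b ha hb v, hpowsplit y z hy hz h, Real.mul_rpow (pow_nonneg ha.le _) (pow_nonneg hy.le _),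
      Real.mul_rpow (pow_nonneg hb.le _) (pow_nonneg hz.le _)]
    ring
  unfold adsPulledZ
  simp_rw [hsplit]
  have hH := Real.inner_le_Lp_mul_Lq_of_nonneg (hpWalks n) hpq
    (f := fun ω => (a ^ wallVisits n ω * y ^ (ω n 0).toNat) ^ θ)
    (g := fun ω => (b ^ wallVisits n ω * z ^ (ω n 0).toNat) ^ (1 - θ))
    (fun ω _ => Real.rpow_nonneg (mul_nonneg (pow_nonneg ha.le _) (pow_nonneg hy.le _)) _)
    (fun ω _ => Real.rpow_nonneg (mul_nonneg (pow_nonneg hb.le _) (pow_nonneg hz.le _)) _)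
  have hf : ∀ ω : ℕ → Site 2, ((a ^ wallVisits n ω * y ^ (ω n 0).toNat) ^ θ) ^ (1 / θ) =
      a ^ wallVisits n ω * y ^ (ω n 0).toNat := fun ω => by
    rw [← Real.rpow_mul (mul_nonneg (pow_nonneg ha.le _) (pow_nonneg hy.le _)), mul_one_div_cancel hθ0.ne', Real.rpow_one]
  have hg : ∀ ω : ℕ → Site 2, ((b ^ wallVisits n ω * z ^ (ω n 0).toNat) ^ (1 - θ)) ^ (1 / (1 - θ)) =
      b ^ wallVisits n ω * z ^ (ω n 0).toNat := fun ω => by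
    rw [← Real.rpow_mul (mul_nonneg (pow_nonneg hb.le _) (pow_nonneg hz.le _)), mul_one_div_cancel h1θ.ne', Real.rpow_one]
  simp only [hf, hg, one_div_one_div] at hH
  exact hH

/-- **`κ(a,y)` as a function of `(log a, log y)`**: `(α, θ) ↦ max(κ(α), λ_B(e^θ))` (`= max[κ(a), λ(y)]`, Theorem 1).
[cite: JansevanRensburgWhittington2013, §2, after eq. (2.5) (arXiv v4 p. 5: «κ(a,y) = max[κ(a), λ(y)]»)] -/
def adsPulledFreeEnergy (p : ℝ × ℝ) : ℝ := max (adsFreeEnergy p.1) (pulledBridgeFreeEnergy 2 (Real.exp p.2))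

/-- `n⁻¹ log C_n(e^α, e^θ) → κ(α, θ)`. [cite: JansevanRensburgWhittington2013, Theorem 1 (arXiv v4 p. 4)] -/
theorem tendsto_log_adsPulledZ_exp (p : ℝ × ℝ) :
    Tendsto (fun n : ℕ => Real.log (adsPulledZ n (Real.exp p.1) (Real.exp p.2)) / n) atTop (𝓝 (adsPulledFreeEnergy p)) := by
  have h := JansevanRensburgWhittington2013_thm1 (Real.exp_pos p.1) (Real.exp_pos p.2)
  rwa [Real.log_exp] at h

/-- **Theorem 2 (Janse van Rensburg–Whittington 2013), `d = 2`: the limiting free energy `κ(a,y)` is a convex function of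
`(log a, log y)`** (finite-`n` Hölder, then the limit of Theorem 1).
[cite: JansevanRensburgWhittington2013, Theorem 2 (arXiv v4 p. 5: «κ(a,y) = lim n⁻¹ log C_n(a,y) is a convex function of log a and log y»)] -/
theorem JansevanRensburgWhittington2013_thm2 : ConvexOn ℝ Set.univ adsPulledFreeEnergy := by
  refine ⟨convex_univ, fun p _ q _ s t hs ht hst => ?_⟩
  -- boundary cases
  rcases hs.eq_or_lt with rfl | hs0
  · rw [zero_add] at hst; subst hst; simp
  rcases ht.eq_or_lt with rfl | ht0
  · rw [add_zero] at hst; subst hst; simp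
  have hs1 : s < 1 := by linarith
  have hts : t = 1 - s := by linarith
  subst hts
  -- finite-`n` inequality
  have hfin : ∀ n : ℕ, Real.log (adsPulledZ n (Real.exp ((s • p + (1 - s) • q).1)) (Real.exp ((s • p + (1 - s) • q).2))) / n ≤
      s • (Real.log (adsPulledZ n (Real.exp p.1) (Real.exp p.2)) / n) +
        (1 - s) • (Real.log (adsPulledZ n (Real.exp q.1) (Real.exp q.2)) / n) := by
    intro n
    have ea : Real.exp ((s • p + (1 - s) • q).1) = Real.exp p.1 ^ s * Real.exp q.1 ^ (1 - s) := by
      simp only [Prod.fst_add, Prod.smul_fst, smul_eq_mul]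
      rw [Real.exp_add, mul_comm s, mul_comm (1 - s), Real.exp_mul, Real.exp_mul]
    have ey : Real.exp ((s • p + (1 - s) • q).2) = Real.exp p.2 ^ s * Real.exp q.2 ^ (1 - s) := by
      simp only [Prod.snd_add, Prod.smul_snd, smul_eq_mul]
      rw [Real.exp_add, mul_comm s, mul_comm (1 - s), Real.exp_mul, Real.exp_mul]
    rw [ea, ey]
    have hH := adsPulledZ_rpow_mul_rpow_le n (Real.exp_pos p.1) (Real.exp_pos q.1) (Real.exp_pos p.2) (Real.exp_pos q.2) hs0 hs1
    have hP := adsPulledZ_pos n (Real.exp_pos p.1).le (Real.exp_pos p.2)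
    have hQ := adsPulledZ_pos n (Real.exp_pos q.1).le (Real.exp_pos q.2)
    have hL : 0 < adsPulledZ n (Real.exp p.1 ^ s * Real.exp q.1 ^ (1 - s)) (Real.exp p.2 ^ s * Real.exp q.2 ^ (1 - s)) :=
      adsPulledZ_pos n (by positivity) (by positivity)
    have hlog := Real.log_le_log hL hH
    rw [Real.log_mul (Real.rpow_pos_of_pos hP _).ne' (Real.rpow_pos_of_pos hQ _).ne', Real.log_rpow hP, Real.log_rpow hQ] at hlog
    rcases Nat.eq_zero_or_pos n with rfl | hn
    · simp
    have hn' : (0 : ℝ) < n := by exact_mod_cast hn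
    simp only [smul_eq_mul]
    rw [div_le_iff₀ hn']
    have e : (s * (Real.log (adsPulledZ n (Real.exp p.1) (Real.exp p.2)) / n) +
        (1 - s) * (Real.log (adsPulledZ n (Real.exp q.1) (Real.exp q.2)) / n)) * n =
        s * Real.log (adsPulledZ n (Real.exp p.1) (Real.exp p.2)) + (1 - s) * Real.log (adsPulledZ n (Real.exp q.1) (Real.exp q.2)) := by
      field_simp
    rw [e]
    exact hlog
  -- pass to the limit
  have hlim := tendsto_log_adsPulledZ_exp (s • p + (1 - s) • q)
  have hlimR := ((tendsto_log_adsPulledZ_exp p).const_smul s).add ((tendsto_log_adsPulledZ_exp q).const_smul (1 - s))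
  exact le_of_tendsto_of_tendsto' hlim hlimR hfin

end Literature.Probability.RandomPlanarGeometry.SAW.Zd
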